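import Mathlib
import HarnessLib
import HarnessLib.Audit
import Summits.Langlands.Langlands.Theorems.RelativeSevenSplit

/-!
# QuarticLiftSplit — lens-5 g36 (kit 6): the QUARTIC-`√5` HALF of the residual range is EXACTLY «strong quartic modularity
# over `√5`-quartics» Q5A lifted through the lineage's OWN base-change binder NSBC — `jDeg = 4 ∧ √5 ∈ ℚ(j)` closes modulo
# NSBC ∧ Q5A on EVERY box field by g27's descent lemma; the residual becomes `[ℚ(j):ℚ] ≥ 5` ONLY (`Residual40`), exact

THESIS.  g27 (`JDegreeFilterSplit`) cut REST_E by the degree of the field of moduli `ℚ(j) ≤ K₀`: `jDeg ≤ 1` (DBC), the BRIDGE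
range `2 ≤ jDeg ≤ 3 ∨ (jDeg = 4 ∧ √5 ∉ ℚ(j))` (closed: FLS Thm 1 / DNS Thm 4 / Box Thm 1.1 over `ℚ(j)`, then NSBC = `SmallFieldBaseChange`
carries weight-zero automorphy from the field of degree `2..4` into `K₀`; twist + CM in `isModularEllipticCurve_of_jInv_eq_algebraMap`), and
the RESIDUAL range `jDeg ≥ 5 ∨ (jDeg = 4 ∧ √5 ∈ ℚ(j))`.  The second disjunct was residual for ONE reason only: Box 2022 Thm 1.1 excludes
quartic fields containing `√5`.  This node names that reason as a binder — **Q5A** `SqrtFiveQuarticAutomorphy`: every integral curve over a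
totally real QUARTIC field CONTAINING `√5` is automorphic of weight zero (= `Box2022_theorem1_1` with `¬ IsSquare 5` replaced by `IsSquare 5`;
OPEN — the strong, Hecke-polynomial form of lg-quartmod's `SqrtFiveQuarticCovers.Target` / `EllipticDegreeLadder.QuarticModularity`
(stmt-Langlands-17832) on the `√5` half) — and runs g27's descent lemma VERBATIM with `F = ℚ⟮j⟯` of degree `4`:
`modular_of_jDeg_four_sqrtFive : SmallFieldBaseChange → SqrtFiveQuarticAutomorphy → UnanchoredBox K₀ → Δ ≠ 0 → jDeg = 4 → √5 ∈ ℚ⟮j⟯ →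
modular`.  Hence at g27's level `LargeJResidual ⟺ QuarticSqrtFiveSector ∧ LargeJResidualFive` (exact, no junction) with the quartic sector
CLOSED modulo NSBC ∧ Q5A, and at the current storey `Residual39` (kit 5) ⟸ NSBC ∧ Q5A ∧ `Residual40`, where `Residual40 :=
GenuineNonSqrtFiveSector38 ∧ GenuineBorelFiveCell40 ∧ H8Cell40 ∧ H12Cell40` — kit 5's genuine pieces with `5 ≤ jDeg K₀ E` inserted (off `√5`
the insertion is vacuous: `five_le_jDeg_of_inResidualRange`), and kit 5's quartic-`j` cell `SqrtFiveQuarticJCell36` CLOSED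
(`sqrtFiveQuarticJCell36_closed`).  EXACT: `Residual39 ↔ Residual40` modulo NSBC ∧ Q5A (`residual40_of_residual39` unconditional).  BY NAME up
the lineage: kit 5's 21 binders PLUS `hQ : SqrtFiveQuarticAutomorphy` (NSBC is already binder 2), `hR : Residual40`.

WHY THIS LINE.  After kits 3–5 the `√5`-sector of the RES36 line had three kinds of cells: EMPTY ones (inherited growth), the Cartan / genuine
cells, and the quartic-`j` cell — «QuarticModularity's object, no door claimed».  There IS a door, and it is the lineage's own: the curve with
`[ℚ(j):ℚ] = 4` is a quadratic twist of the base change of an `𝓞_{ℚ(j)}`-model of `j` (g27, `jModel`), so its modularity over `K₀` is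
(automorphy over the quartic `ℚ(j)`) + (base change `ℚ(j) → K₀` = NSBC, ALREADY a binder of every `closes_byName` since g27) + (twist
invariance, in the tree).  Typing it makes the residual of the whole line uniform: GENUINE-growth fields × curves with `[ℚ(j):ℚ] ≥ 5`, and
turns the quartic-`j` cell into an explicit CROSS-CELL EDGE to lg-quartmod (their Target, strong form) instead of an orphan.  Nearest tree
prior art: g27 `JDegreeFilterSplitBridge.smallFieldJDoor_of_bridge` (the same lemma with Box Thm 1.1) — DELTA: the `√5`-quartic case with the
open input named; lg-quartmod `SqrtFiveQuarticCovers` (modularity over the quartic field itself) — DELTA: the LIFT to box fields above it.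

RANKED CRUXES.  `Residual40` (rank 2; RESIDUAL, WEAKER, EXACT modulo NSBC ∧ Q5A): genuine-growth pieces on curves with `[ℚ(j):ℚ] ≥ 5`.
`SqrtFiveQuarticAutomorphy` (rank 3; OPEN binder — NOT print: Box 2022 Thm 1.1's excluded case; lg-quartmod's programme proves its weak
form cell by cell).  KILL CRITERIA.  A non-automorphic integral curve over a totally real quartic field containing `√5` (none is expected:
potential modularity + the FLS/Box method leave finitely many `j` up to the known obstructions).  NOT DECOMPOSED YET.  `Residual40`'s pieces
(genuine `15`/`7`-growth × `jDeg ≥ 5`; HEPT).  CHEAPEST FALSIFIER.  `lean check` of the S0 example `modular_of_jDeg_four_sqrtFive` failing to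
find `IsTotallyReal ℚ⟮j⟯` / the `Algebra ℚ⟮j⟯ K₀` instance path used by g27 (it elaborates: kernel rc 0).
HONEST STATUS.  CONDITIONAL node with ONE MORE binder than kit 5 (22): Q5A is an OPEN statement (declared as such), NSBC an existing open
leaf; nothing here proves a curve modular outright.  WEAK vs STRONG: lg-quartmod's Target concludes `IsModularEllipticCurve` (CM ∨ cofinitely
many Satake matches); NSBC consumes `IsAutomorphicOfWeightZero` (Hecke polynomials at all `w ∤ Δ`); no weak → strong lemma is in the tree
(multiplicity one + CM automorphic induction), so Q5A is typed in the strong form, exactly like `Box2022_theorem1_1`.  Count-neutral NODE.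
References: [Box2022] arXiv:2103.13975 Thm 1.1 (quartic fields not containing `√5`); [FreitasLeHungSiksek2015] arXiv:1310.7088 (twist /
`j`-model method); g27 `JDegreeFilterSplitPrelude` / `JDegreeFilterSplitBridge` (tree); lg-quartmod `Theses/SqrtFiveQuarticCovers.lean` (Target,
stmt-Langlands-17832's sibling), `Theses/EllipticDegreeLadder.QuarticModularity`.
-/

set_option linter.dupNamespace false -- project-wide option; `Summit.Langlands.Langlands` is the mandated namespace

open scoped NumberField IntermediateField MatrixGroups
open NumberField Field Literature.NumberTheory.Automorphic
open Literature.NumberTheory.GaloisRepresentations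
open Summit.Langlands.Langlands.Theorems.DepthIsolationSplit (UnanchoredBox UnanchoredHighDegreeModularE IntegralModelTransferPointwise)
open Summit.Langlands.Langlands.Theorems.JDegreeFilterSplit (jInv jDeg InBridgeRange InResidualRange RatBaseChangeModularity
  SmallFieldBaseChange LargeJResidual RationalJDoor SmallFieldJDoor isModularEllipticCurve_of_jInv_eq_algebraMap restE_of_jSectors
  rationalJDoor_of_ratBaseChange smallFieldJDoor_of_bridge)
open Summit.Langlands.Langlands.Theorems.DyadicDoorSplit (AllenLocus AllenDyadicCorollary)
open Summit.Langlands.Langlands.Theorems.OddPrimeDoorSplit (OffDoors SkinnerWilesDihedralDoor PanZhangSupersingularDoor)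
open Summit.Langlands.Langlands.Theorems.RealCyclotomicDoorSplit (BorelAt BorelOrSplitCartanThree)
open Summit.Langlands.Langlands.Theorems.ReductionSignatureSplit (OffSignatureDoors NearlyOrdinaryDihedralDoorThree
  SplitOrdinaryDihedralDoor MixedSignatureDoor)
open Summit.Langlands.Langlands.Theorems.NearlyOrdinaryDistinguishedSplit (OnNODDoor NearlyOrdinaryDistinguishedDoor)
open Summit.Langlands.Langlands.Theorems.MordellWeilFifteenSplit (Growth)
open Summit.Langlands.Langlands.Theorems.MordellWeilSevenSplit (SevenGrowth)
open Summit.Langlands.Langlands.Theorems.CartanFiveSplit (H8At H12At Residual37)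
open Summit.Langlands.Langlands.Theorems.RelativeFifteenSplit (RelativeFifteenDoor Residual38)
open Summit.Langlands.Langlands.Theorems.RelativeSevenSplit (FifteenInherited SevenQuadInherited RelativeSevenDoor
  GenuineNonSqrtFiveSector38 SqrtFiveQuarticJCell36 GenuineBorelFiveCell38 H8Cell38 H12Cell38 Residual39 isSquare_five_of_adjoin
  residual38_of_pieces39 residual37_of_pieces39)

namespace Summit.Langlands.Langlands.Theorems.QuarticLiftSplit

/-! ## §1 The ONE new binder Q5A (OPEN, strong form), and its union with Box Thm 1.1 -/

/-- **Q5A — STRONG QUARTIC MODULARITY OVER `√5`-QUARTICS** (OPEN binder; NOT print).  Every integral `E` with `Δ ≠ 0` over a totally real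
quartic number field CONTAINING `√5` is automorphic of weight zero — `Box2022_theorem1_1` with `¬ IsSquare (5 : K)` replaced by
`IsSquare (5 : K)` (Box's excluded case: over `ℚ(ζ₅)⁺ ⊆ K` the mod-`5` image may be too small for the 3–5 / 5–7 switch).  The WEAK form
(`IsModularEllipticCurve`) for all totally real quartics is lg-quartmod's `SqrtFiveQuarticCovers.Target` =
`EllipticDegreeLadder.QuarticModularity`; no weak → strong lemma is in the tree, so the binder is typed in the strong form NSBC consumes.
[ref: Box2022, Thm 1.1 and §1 (the `√5` exclusion)] -/
def SqrtFiveQuarticAutomorphy : Prop :=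
  ∀ (K : Type) [Field K] [NumberField K] [IsTotallyReal K], Module.finrank ℚ K = 4 →
    IsSquare (5 : K) → ∀ E : WeierstrassCurve (𝓞 K), E.Δ ≠ 0 → IsAutomorphicOfWeightZero E

/-- Box Thm 1.1 ∧ Q5A = weight-zero automorphy over EVERY totally real quartic field (excluded middle on `√5 ∈ K`). -/
theorem quartic_automorphy_of_box11_and_q5a (hBox : Box2022_theorem1_1) (hQ : SqrtFiveQuarticAutomorphy) (K : Type) [Field K]
    [NumberField K] [IsTotallyReal K] (h4 : Module.finrank ℚ K = 4) (E : WeierstrassCurve (𝓞 K)) (hΔ : E.Δ ≠ 0) :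
    IsAutomorphicOfWeightZero E := by
  by_cases h5 : IsSquare (5 : K)
  · exact hQ K h4 h5 E hΔ
  · exact hBox K h4 h5 E hΔ

/-! ## §2 KERNEL: the quartic-`√5` part of the residual range closes modulo NSBC ∧ Q5A (g27's descent lemma, verbatim) -/

/-- **THE LIFT.**  Over a box field `K₀`, an integral `E` with `[ℚ(j):ℚ] = 4` and `√5 ∈ ℚ(j)` is modular, modulo NSBC ∧ Q5A: every integral
curve over the totally real quartic `F = ℚ⟮j⟯ ∋ √5` is automorphic of weight zero (Q5A), NSBC base-changes that automorphy into `K₀`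
(`2 ≤ 4 ≤ 4`), and `isModularEllipticCurve_of_jInv_eq_algebraMap` (g27: CM at `j ∈ {0, 1728}`, else `E` is a quadratic twist of the base
change of `jModel p q / 𝓞 F`, twist invariance `isModularEllipticCurve_of_jInvariant_eq_holds`) finishes. -/
theorem modular_of_jDeg_four_sqrtFive (hBC : SmallFieldBaseChange) (hQ : SqrtFiveQuarticAutomorphy) (K₀ : Type) [Field K₀]
    [NumberField K₀] (hbox : UnanchoredBox K₀) (E : WeierstrassCurve (𝓞 K₀)) (hΔ : E.Δ ≠ 0) (h4 : jDeg K₀ E = 4)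
    (h5 : IsSquare (5 : ℚ⟮jInv K₀ E⟯)) : IsModularEllipticCurve K₀ E := by
  haveI : IsTotallyReal K₀ := hbox.1
  have h4' : Module.finrank ℚ ℚ⟮jInv K₀ E⟯ = 4 := h4
  have hbc : ∀ E₀ : WeierstrassCurve (𝓞 ℚ⟮jInv K₀ E⟯), E₀.Δ ≠ 0 → IsAutomorphicOfWeightZero E₀ →
      IsModularEllipticCurve K₀ (E₀.baseChange (𝓞 K₀)) :=
    fun E₀ hΔ₀ haut => hBC K₀ hbox ℚ⟮jInv K₀ E⟯ (by omega) (by omega) E₀ hΔ₀ haut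
  exact isModularEllipticCurve_of_jInv_eq_algebraMap ℚ⟮jInv K₀ E⟯ K₀ (fun E₀ hΔ₀ => hQ _ h4' h5 E₀ hΔ₀) hbc E hΔ
    ⟨jInv K₀ E, IntermediateField.mem_adjoin_simple_self ℚ _⟩ rfl

/-- KERNEL: in the residual range, `jDeg ≠ 4` means `jDeg ≥ 5`, and `jDeg = 4` means `√5 ∈ ℚ(j)`. -/
theorem inResidualRange_cases {K₀ : Type} [Field K₀] [NumberField K₀] {E : WeierstrassCurve (𝓞 K₀)} (hr : InResidualRange K₀ E) :
    5 ≤ jDeg K₀ E ∨ (jDeg K₀ E = 4 ∧ IsSquare (5 : ℚ⟮jInv K₀ E⟯)) := hr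

/-- KERNEL: OFF the `√5`-sector the residual range is `jDeg ≥ 5` already (`√5 ∈ ℚ⟮j⟯ ≤ K₀` would put `√5` in `K₀`; kit 5). -/
theorem five_le_jDeg_of_inResidualRange {K₀ : Type} [Field K₀] [NumberField K₀] {E : WeierstrassCurve (𝓞 K₀)}
    (h5 : ¬ IsSquare (5 : K₀)) (hr : InResidualRange K₀ E) : 5 ≤ jDeg K₀ E := by
  rcases hr with h | ⟨-, hsq⟩
  · exact h
  · exact absurd (isSquare_five_of_adjoin E hsq) h5

/-- **The residual range modulo NSBC ∧ Q5A is `jDeg ≥ 5`:** over a box field a NON-modular curve in the residual range has `[ℚ(j):ℚ] ≥ 5`. -/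
theorem five_le_jDeg_of_not_modular (hBC : SmallFieldBaseChange) (hQ : SqrtFiveQuarticAutomorphy) (K₀ : Type) [Field K₀]
    [NumberField K₀] (hbox : UnanchoredBox K₀) (E : WeierstrassCurve (𝓞 K₀)) (hΔ : E.Δ ≠ 0) (hr : InResidualRange K₀ E)
    (hne : ¬ IsModularEllipticCurve K₀ E) : 5 ≤ jDeg K₀ E := by
  rcases hr with h | ⟨h4, h5⟩
  · exact h
  · exact absurd (modular_of_jDeg_four_sqrtFive hBC hQ K₀ hbox E hΔ h4 h5) hne

/-! ## §3 At g27's storey: LJR ⟺ (quartic-`√5` sector) ∧ (degree-`≥ 5` residual), the first CLOSED modulo NSBC ∧ Q5A -/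

/-- The QUARTIC-`√5` SECTOR of g27's residual range (CLOSED modulo NSBC ∧ Q5A). -/
def QuarticSqrtFiveSector : Prop :=
  ∀ (K₀ : Type) [Field K₀] [NumberField K₀], UnanchoredBox K₀ →
    ∀ E : WeierstrassCurve (𝓞 K₀), E.Δ ≠ 0 → jDeg K₀ E = 4 → IsSquare (5 : ℚ⟮jInv K₀ E⟯) → IsModularEllipticCurve K₀ E

/-- LJR₅ — g27's residual on curves whose field of moduli has degree `≥ 5` (RESIDUAL at g27's storey; the lineage g28–g36 refines it). -/
def LargeJResidualFive : Prop :=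
  ∀ (K₀ : Type) [Field K₀] [NumberField K₀], UnanchoredBox K₀ →
    ∀ E : WeierstrassCurve (𝓞 K₀), E.Δ ≠ 0 → 5 ≤ jDeg K₀ E → IsModularEllipticCurve K₀ E

/-- EXACTNESS at g27's storey (no junction): LJR ⟺ quartic-`√5` sector ∧ LJR₅. -/
theorem largeJResidual_iff : LargeJResidual ↔ QuarticSqrtFiveSector ∧ LargeJResidualFive := by
  refine ⟨fun h => ⟨fun K₀ _ _ hb E hΔ h4 h5 => h K₀ hb E hΔ (Or.inr ⟨h4, h5⟩),
    fun K₀ _ _ hb E hΔ h5 => h K₀ hb E hΔ (Or.inl h5)⟩, ?_⟩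
  rintro ⟨hq, h5⟩ K₀ _ _ hb E hΔ (h | ⟨h4, hsq⟩)
  · exact h5 K₀ hb E hΔ h
  · exact hq K₀ hb E hΔ h4 hsq

/-- **The quartic-`√5` sector is CLOSED modulo NSBC ∧ Q5A.** -/
theorem quarticSqrtFiveSector_closed (hBC : SmallFieldBaseChange) (hQ : SqrtFiveQuarticAutomorphy) : QuarticSqrtFiveSector :=
  fun K₀ _ _ hb E hΔ h4 h5 => modular_of_jDeg_four_sqrtFive hBC hQ K₀ hb E hΔ h4 h5

/-- LJR ⟸ NSBC ∧ Q5A ∧ LJR₅. -/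
theorem largeJResidual_of_five (hBC : SmallFieldBaseChange) (hQ : SqrtFiveQuarticAutomorphy) (h : LargeJResidualFive) :
    LargeJResidual :=
  largeJResidual_iff.mpr ⟨quarticSqrtFiveSector_closed hBC hQ, h⟩

/-- **REST_E ⟸ DBC ∧ NSBC ∧ FLS Thm 1 ∧ DNS Thm 4 ∧ Box Thm 1.1 ∧ Q5A ∧ LJR₅** — g27's `restE_of_jLeaves` with the residual range
shrunk to `jDeg ≥ 5`: modulo print, the two open base-change leaves and Q5A, a NON-modular curve over a box field has `[ℚ(j):ℚ] ≥ 5`. -/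
theorem restE_of_five (hDBC : RatBaseChangeModularity) (hNSBC : SmallFieldBaseChange) (hFLS : FLS2015_theorem1)
    (hDNS : DNS2020_theorem4) (hBox : Box2022_theorem1_1) (hQ : SqrtFiveQuarticAutomorphy) (h : LargeJResidualFive) :
    UnanchoredHighDegreeModularE :=
  restE_of_jSectors (rationalJDoor_of_ratBaseChange hDBC) (smallFieldJDoor_of_bridge hNSBC hFLS hDNS hBox)
    (largeJResidual_of_five hNSBC hQ h)

/-! ## §4 At the current storey: the pieces of `Residual39` on `[ℚ(j):ℚ] ≥ 5`; the quartic-`j` cell CLOSED -/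

/-- GENUINE Borel-`5` cell of the `√5`-sector on curves with `[ℚ(j):ℚ] ≥ 5` (RESIDUAL): kit 5's `GenuineBorelFiveCell38` + `5 ≤ jDeg`. -/
def GenuineBorelFiveCell40 : Prop :=
  ∀ (K₀ : Type) [Field K₀] [NumberField K₀], UnanchoredBox K₀ → Growth K₀ → SevenGrowth K₀ → IsSquare (5 : K₀) →
    ¬ FifteenInherited K₀ → ¬ SevenQuadInherited K₀ →
    ∀ E : WeierstrassCurve (𝓞 K₀), E.Δ ≠ 0 → InResidualRange K₀ E → 5 ≤ jDeg K₀ E → ¬ AllenLocus K₀ E → OffDoors K₀ E →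
      OffSignatureDoors K₀ E → ¬ OnNODDoor K₀ E → BorelOrSplitCartanThree K₀ E → BorelAt K₀ E 5 →
        IsModularEllipticCurve K₀ E

/-- `H8` Cartan cell on curves with `[ℚ(j):ℚ] ≥ 5` (RESIDUAL): kit 5's `H8Cell38` + `5 ≤ jDeg`. -/
def H8Cell40 : Prop :=
  ∀ (K₀ : Type) [Field K₀] [NumberField K₀], UnanchoredBox K₀ → Growth K₀ → SevenGrowth K₀ → IsSquare (5 : K₀) →
    ¬ SevenQuadInherited K₀ →
    ∀ E : WeierstrassCurve (𝓞 K₀), E.Δ ≠ 0 → InResidualRange K₀ E → 5 ≤ jDeg K₀ E → ¬ AllenLocus K₀ E → OffDoors K₀ E →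
      OffSignatureDoors K₀ E → ¬ OnNODDoor K₀ E → BorelOrSplitCartanThree K₀ E → H8At K₀ E →
        IsModularEllipticCurve K₀ E

/-- `H12` Cartan cell on curves with `[ℚ(j):ℚ] ≥ 5` (RESIDUAL): kit 5's `H12Cell38` + `5 ≤ jDeg`. -/
def H12Cell40 : Prop :=
  ∀ (K₀ : Type) [Field K₀] [NumberField K₀], UnanchoredBox K₀ → Growth K₀ → SevenGrowth K₀ → IsSquare (5 : K₀) →
    ¬ SevenQuadInherited K₀ →
    ∀ E : WeierstrassCurve (𝓞 K₀), E.Δ ≠ 0 → InResidualRange K₀ E → 5 ≤ jDeg K₀ E → ¬ AllenLocus K₀ E → OffDoors K₀ E →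
      OffSignatureDoors K₀ E → ¬ OnNODDoor K₀ E → BorelOrSplitCartanThree K₀ E → H12At K₀ E →
        IsModularEllipticCurve K₀ E

/-- **Residual40 — THE DECLARED RESIDUAL**: kit 5's genuine pieces on curves with `[ℚ(j):ℚ] ≥ 5` (off `√5` kit 5's piece BY NAME — there the
residual range is `≥ 5` already).  WEAKER than `Residual39` unconditionally; gives it back modulo NSBC ∧ Q5A. -/
def Residual40 : Prop :=
  GenuineNonSqrtFiveSector38 ∧ GenuineBorelFiveCell40 ∧ H8Cell40 ∧ H12Cell40

/-- **Kit 5's quartic-`j` cell is CLOSED modulo NSBC ∧ Q5A** (its hypotheses `√5 ∈ K₀`, `4 ∣ d`, seven-inheritance, doors are not even used: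
`jDeg = 4` in the residual range forces `√5 ∈ ℚ(j)`, and the lift applies on every box field). -/
theorem sqrtFiveQuarticJCell36_closed (hBC : SmallFieldBaseChange) (hQ : SqrtFiveQuarticAutomorphy) : SqrtFiveQuarticJCell36 := by
  intro K₀ _ _ hU _ _ _ _ _ E hΔ hr _ _ _ _ h4
  rcases hr with h | ⟨-, h5⟩
  · omega
  · exact modular_of_jDeg_four_sqrtFive hBC hQ K₀ hU E hΔ h4 h5

/-- **`Residual39` from the pieces**: NSBC ∧ Q5A ∧ `Residual40` ⇒ `Residual39`. -/
theorem residual39_of_pieces40 (hBC : SmallFieldBaseChange) (hQ : SqrtFiveQuarticAutomorphy) (h : Residual40) : Residual39 := by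
  obtain ⟨hGNS, hGB5, h8, h12⟩ := h
  refine ⟨hGNS, sqrtFiveQuarticJCell36_closed hBC hQ, ?_, ?_, ?_⟩
  · intro K₀ _ _ hU hG hS h5 hq15 hq7 E hΔ hr hA hO hSig hN h3 hb
    by_contra hne
    exact hne (hGB5 K₀ hU hG hS h5 hq15 hq7 E hΔ hr (five_le_jDeg_of_not_modular hBC hQ K₀ hU E hΔ hr hne) hA hO hSig hN h3 hb)
  · intro K₀ _ _ hU hG hS h5 hq7 E hΔ hr hA hO hSig hN h3 h8At
    by_contra hne
    exact hne (h8 K₀ hU hG hS h5 hq7 E hΔ hr (five_le_jDeg_of_not_modular hBC hQ K₀ hU E hΔ hr hne) hA hO hSig hN h3 h8At)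
  · intro K₀ _ _ hU hG hS h5 hq7 E hΔ hr hA hO hSig hN h3 h12At
    by_contra hne
    exact hne (h12 K₀ hU hG hS h5 hq7 E hΔ hr (five_le_jDeg_of_not_modular hBC hQ K₀ hU E hΔ hr hne) hA hO hSig hN h3 h12At)

/-- **`Residual40` from `Residual39`** (unconditional restriction). -/
theorem residual40_of_residual39 (h : Residual39) : Residual40 := by
  obtain ⟨hGNS, -, hGB5, h8, h12⟩ := h
  exact ⟨hGNS, fun K₀ _ _ hU hG hS h5 hq15 hq7 E hΔ hr _ hA hO hSig hN h3 hb => hGB5 K₀ hU hG hS h5 hq15 hq7 E hΔ hr hA hO hSig hN h3 hb,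
    fun K₀ _ _ hU hG hS h5 hq7 E hΔ hr _ hA hO hSig hN h3 h8At => h8 K₀ hU hG hS h5 hq7 E hΔ hr hA hO hSig hN h3 h8At,
    fun K₀ _ _ hU hG hS h5 hq7 E hΔ hr _ hA hO hSig hN h3 h12At => h12 K₀ hU hG hS h5 hq7 E hΔ hr hA hO hSig hN h3 h12At⟩

/-- **EXACTNESS**: modulo NSBC ∧ Q5A, `Residual39 ↔ Residual40`. -/
theorem residual39_iff_residual40 (hBC : SmallFieldBaseChange) (hQ : SqrtFiveQuarticAutomorphy) : Residual39 ↔ Residual40 :=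
  ⟨residual40_of_residual39, residual39_of_pieces40 hBC hQ⟩

/-- Two storeys: `Residual38` ⟸ BOX13 ∧ RFD ∧ RSD ∧ NSBC ∧ Q5A ∧ `Residual40`. -/
theorem residual38_of_pieces40 (hB : Box2022_theorem1_3) (hF : RelativeFifteenDoor) (hR : RelativeSevenDoor) (hBC : SmallFieldBaseChange)
    (hQ : SqrtFiveQuarticAutomorphy) (h : Residual40) : Residual38 :=
  residual38_of_pieces39 hB hF hR (residual39_of_pieces40 hBC hQ h)

/-! ## §5 BY NAME up the lineage: kit 5's binders PLUS `hQ : SqrtFiveQuarticAutomorphy`, residual `Residual40` -/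

/-- **REST (stmt-Langlands-26998) BY NAME**: kit 5's `RelativeSevenSplit.closes_byName` (21 binders; NSBC = binder 2) with `hR : Residual39`
replaced by `hQ : SqrtFiveQuarticAutomorphy` (ONE NEW, OPEN binder) and `hR : Residual40`.  CONDITIONAL display via `closure.modulo`; credits
nothing. -/
theorem closes_byName (hDBC : RatBaseChangeModularity) (hNSBC : SmallFieldBaseChange)
    (hFLS : FLS2015_theorem1) (hDNS : DNS2020_theorem4) (hBox : Box2022_theorem1_1)
    (hADC : AllenDyadicCorollary) (h34 : FLS2015_theorems3_4) (hSW : SkinnerWilesDihedralDoor)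
    (hPZ : PanZhangSupersingularDoor) (hNO3 : NearlyOrdinaryDihedralDoorThree) (hNOS : SplitOrdinaryDihedralDoor)
    (hMIX : MixedSignatureDoor) (hNOD : NearlyOrdinaryDistinguishedDoor) (hB : Box2022_theorem1_3)
    (hRFD : RelativeFifteenDoor) (hRSD : RelativeSevenDoor) (hQ : SqrtFiveQuarticAutomorphy) (hR : Residual40)
    (hIMT : IntegralModelTransferPointwise)
    (hTr : Summit.Langlands.Langlands.Theses.EllipticDegreeLadder.EllipticTransportAnyBase)
    (hW : Summit.Langlands.Langlands.Theses.EllipticDegreeLadder.SatakeAvatarExistence)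
    (h1 : Summit.Langlands.Langlands.Theses.EllipticDegreeLadder.RankOneAutomorphy) :
    Summit.Langlands.Langlands.Theses.TowerDoorSplit.UnanchoredHighDegreeWitnessAutomorphy :=
  Summit.Langlands.Langlands.Theorems.RelativeSevenSplit.closes_byName hDBC hNSBC hFLS hDNS hBox hADC h34 hSW hPZ hNO3 hNOS hMIX
    hNOD hB hRFD hRSD (residual39_of_pieces40 hNSBC hQ hR) hIMT hTr hW h1

end Summit.Langlands.Langlands.Theorems.QuarticLiftSplit
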